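import Literature.NumberTheory.EllipticCurves.NonvanishingTwists
import Literature.NumberTheory.EllipticCurves.Tamagawa
import HarnessLib

/-!
# Non-vanishing quadratic twists with prescribed INERT primes (Friedberg–Hoffstein 1995, Thm. B,
# the special case used by Jetchev–Skinner–Wan, Camb. J. Math. 5 (2017) §7.4.2: the field `K″`)

Literature reproduction file (one named fact `def … : Prop`, D-0014; nothing asserted). Companion of
`NonvanishingTwists.lean` (`waldspurger_exists_heegnerField_twist_ne_zero`: all primes of `N` split),
`BSDSelmerPConverse.friedbergHoffstein_exists_heegnerField_split_twist_ne_zero` (all primes of `N` and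
a further prime split) and `NonvanishingTwistsPrescribedRamification.lean` (one prescribed RAMIFIED
prime): here a finite set `S` of multiplicative primes of `E`, of EVEN cardinality, is required to be
INERT in the imaginary quadratic field and every other prime of the conductor to SPLIT — the second
auxiliary field `K″` of Jetchev–Skinner–Wan 2017 §7.4.2 (hypothesis (H) of their §4.1 with
`N⁻ = ∏_{ℓ ∈ S} ℓ`), consumed by the cell `b2b-bsdres`'s X11b route p2
(`Summits/BirchSwinnertonDyer/Rank1Residual/X11b/BDPRouteUpperLinks*.lean`).

Sources.
* [FriedbergHoffstein1995] S. Friedberg, J. Hoffstein, *Nonvanishing theorems for automorphic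
  `L`-functions on GL(2)*, Ann. of Math. 142 (1995) 385–423, **Theorem B** (text not held: JSTOR
  only, acquisition acq-00930 is cite-only; paraphrase as in the sibling files): for a cuspidal
  automorphic representation `π` of `GL₂` over a number field `F`, a finite set `Σ` of places and
  quadratic characters `(χ_v)_{v ∈ Σ}` of the `F_v^×`, if some quadratic Hecke character `ξ` with
  `ξ_v = χ_v` (`v ∈ Σ`) has `ε(π ⊗ ξ, 1/2) = +1`, then infinitely many quadratic `χ` with the
  prescribed local components at `v ∈ Σ` have `L(π ⊗ χ, 1/2) ≠ 0`.
* [JetchevSkinnerWan2017] D. Jetchev, C. Skinner, X. Wan, Camb. J. Math. 5 (2017) 369–434 =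
  arXiv:1512.06894, **§7.4.2, p. 31**, the USE (verbatim): "We choose a second auxiliary imaginary
  quadratic field `ℚ(√D″)` of discriminant `D″ < 0` such that (a) the primes dividing `N⁺` split in
  `𝒦″`; (b) the primes dividing `N⁻` are all inert in `𝒦″`; (c) `p` splits in `𝒦″`;
  (d) `L(E^{D″}, 1) ≠ 0`. Note that (H) holds for `N` and any `𝒦″` satisfying (a), (b), and (c). As
  with the choice of `𝒦′` above, the root number of the quadratic twist `E^{D″}` is `+1` and the
  result of Friedberg and Hoffstein ensures that `𝒦″` can be chosen so that (d) also holds." — with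
  **(H), §4.1 p. 17** (verbatim): "`N = N⁺N⁻` with `(N⁺,N⁻) = 1`; `ℓ ∣ N⁺` if and only if `ℓ` splits
  in `𝒦`; `ℓ ∣ N⁻` if and only if `ℓ` is inert in `𝒦`; `N⁻` is squarefree with an even number of
  prime factors", and the SIGN, p. 17 (verbatim): "The third and forth assumption of either
  Heegner-type hypothesis implies that the epsilon factor `ε(π,𝒦,s)` of the base change of `π` to
  `GL₂(𝔸_𝒦)` satisfies `ε(π,𝒦,1/2) = −1`." Hence for `E` of root number `−1` and `𝒦″` as in
  (a)–(b) (all primes of `N` unramified, the inert ones square-free in `N` — i.e. multiplicative — and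
  even in number): `w(E)·w(E^{D″}) = w(E/𝒦″) = −1`, so `w(E^{D″}) = +1` — the sign hypothesis of
  Friedberg–Hoffstein for the prescribed local data (`χ_ℓ` the unramified quadratic character at
  `ℓ ∈ S`, `χ_ℓ = 1` at the other primes of `N`, `χ_∞ = sgn`).

Transcription (tree vocabulary, as in the sibling files): `W/ℚ` elliptic with `W.rootNumber = -1`;
`S` a finite set of primes of multiplicative reduction (`HasMultiplicativeReductionAtPrime`) with
`Even S.card`; conclusion: for every bound `B` an imaginary quadratic `K` (`IsImaginaryQuadratic`)
with `|d_K| > B`, every `ℓ ∈ S` INERT (`((ℓ).primesOver 𝓞_K).ncard = 1` and `ℓ ∤ d_K`), every other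
prime `ℓ ∣ N_W = W.conductorNorm ℤ` SPLIT (`((ℓ).primesOver 𝓞_K).ncard = 2`), and `L(W^{(d_K)}, 1) ≠ 0`
(`(W.quadraticTwist d_K).entireLFunction 1 ≠ 0`). (JSW's (c) "`p` splits" is their `p ∤ N` setting;
for a prime `p ∣ N`, `p ∉ S`, it is part of the split clause.) Nothing is asserted; users take
`(h : friedbergHoffstein_exists_twist_ne_zero_inertAt)`.
-/

noncomputable section

open scoped Classical

open WeierstrassCurve NumberField

namespace Literature.NumberTheory.EllipticCurves

/-- **Non-vanishing quadratic twist with prescribed inert primes and prescribed splitting**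
(Friedberg–Hoffstein, Ann. of Math. 142 (1995), Thm. B, in the special case USED by
Jetchev–Skinner–Wan, Camb. J. Math. 5 (2017) §7.4.2, p. 31: "We choose a second auxiliary imaginary
quadratic field `ℚ(√D″)` … such that (a) the primes dividing `N⁺` split in `𝒦″`; (b) the primes
dividing `N⁻` are all inert in `𝒦″`; (c) `p` splits in `𝒦″`; (d) `L(E^{D″}, 1) ≠ 0`. Note that (H)
holds for `N` and any `𝒦″` satisfying (a), (b), and (c). … the root number of the quadratic twist
`E^{D″}` is `+1` and the result of Friedberg and Hoffstein ensures that `𝒦″` can be chosen so that (d)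
also holds", (H) of their §4.1 (p. 17) requiring `N⁻` square-free with an EVEN number of prime
factors, whence `ε(π,𝒦″,1/2) = −1` (p. 17) and `w(E^{D″}) = +1` when `w(E) = −1`). For `W/ℚ` elliptic
with `w(E) = −1` and `S` a finite set of primes of multiplicative reduction of even cardinality: for
every bound `B` there is an imaginary quadratic field `K` with `|d_K| > B`, every `ℓ ∈ S` inert in `K`
(one prime of `𝓞_K` above `ℓ` and `ℓ ∤ d_K`), every prime `ℓ ∣ N_W` outside `S` split in `K`, and
`L(W^{(d_K)}, 1) ≠ 0`. Friedberg–Hoffstein's text is not held (acq-00930, cite-only); the general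
statement is paraphrased in the module docstring. Named fact; nothing asserted.
-- TODO(general form): Friedberg–Hoffstein Thm. B for any cuspidal `π` on `GL₂/F`, any finite set
-- of places with prescribed quadratic local components and either sign.
[cite: FriedbergHoffstein1995, Thm. B (special case below)]
[cite: JetchevSkinnerWan2017, §7.4.2 (arXiv:1512.06894 p. 31), choice of K″; §4.1 (H) and the sign, p. 17] -/
def friedbergHoffstein_exists_twist_ne_zero_inertAt : Prop :=
  ∀ (W : WeierstrassCurve ℚ) [W.IsElliptic], W.rootNumber = -1 →
    ∀ (S : Finset ℕ), (∀ ℓ ∈ S, ∃ _ : Fact ℓ.Prime, W.HasMultiplicativeReductionAtPrime ℓ) →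
      Even S.card →
    ∀ B : ℕ, ∃ (K : Type) (_ : Field K) (_ : NumberField K),
      IsImaginaryQuadratic K ∧ B < (NumberField.discr K).natAbs ∧
        (∀ ℓ ∈ S, ((Ideal.span {(ℓ : ℤ)}).primesOver (𝓞 K)).ncard = 1 ∧
          ¬ (ℓ : ℤ) ∣ NumberField.discr K) ∧
        (∀ ℓ : ℕ, ℓ.Prime → ℓ ∣ W.conductorNorm ℤ → ℓ ∉ S →
          ((Ideal.span {(ℓ : ℤ)}).primesOver (𝓞 K)).ncard = 2) ∧
        (W.quadraticTwist (NumberField.discr K : ℚ)).entireLFunction 1 ≠ 0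

end Literature.NumberTheory.EllipticCurves

end

/-! ## Relocated from `Summits/BirchSwinnertonDyer/BirchSwinnertonDyer/Theorems/RamifiedHeegnerPairLeafRankOneUpperAtThreeShimuraInertOddSupply.lean` (gate, accept-time relocation of cited facts) — FriedbergHoffstein1995, JetchevSkinnerWan2017 -/

namespace Literature.NumberTheory.EllipticCurves

open scoped Classical NumberField
open WeierstrassCurve NumberField IsDedekindDomain Literature Literature.NumberTheory.EllipticCurves

/-- **Non-vanishing quadratic twist with prescribed inert primes and prescribed splitting of the conductor and of an auxiliary
integer** (Friedberg–Hoffstein, Ann. of Math. 142 (1995), Thm. B, in the special case USED by Jetchev–Skinner–Wan, Camb. J. Math. 5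
(2017) §7.4.2, p. 31: "We choose a second auxiliary imaginary quadratic field `ℚ(√D″)` of discriminant `D″ < 0` such that (a) the
primes dividing `N⁺` split in `𝒦″`; (b) the primes dividing `N⁻` are all inert in `𝒦″`; (c) `p` splits in `𝒦″`; (d) `L(E^{D″}, 1) ≠ 0`.
Note that (H) holds for `N` and any `𝒦″` satisfying (a), (b), and (c). … the root number of the quadratic twist `E^{D″}` is `+1` and the
result of Friedberg and Hoffstein ensures that `𝒦″` can be chosen so that (d) also holds" — there `p ∤ N`, so (c) is a splitting
condition at an AUXILIARY prime; (H) of their §4.1 (p. 17) requires `N⁻` square-free with an EVEN number of prime factors, whence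
`ε(π,𝒦″,1/2) = −1` and `w(E^{D″}) = +1` when `w(E) = −1`; the local characters at the auxiliary split primes are trivial, so the sign is
that of the sibling `friedbergHoffstein_exists_twist_ne_zero_inertAt`, which is this statement with clause (c) dropped). For `W/ℚ`
elliptic with `w(E) = −1`, `S` a finite set of primes of multiplicative reduction of even cardinality, and an integer `M ≠ 0`: for every
bound `B` there is an imaginary quadratic field `K` with `|d_K| > B`, every `ℓ ∈ S` inert in `K` (one prime above `ℓ`, `ℓ ∤ d_K`), every
prime `ℓ ∣ N_W` outside `S` split, every prime `ℓ ∣ M` outside `S` split, and `L(W^{(d_K)}, 1) ≠ 0`. Friedberg–Hoffstein's text is not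
held (acq-00930, cite-only); the general Thm. B is paraphrased in the module docstring of the sibling file. Named fact; nothing asserted.
-- TODO(general form): Friedberg–Hoffstein Thm. B for any cuspidal `π` on `GL₂/F`, any finite set of places with prescribed quadratic
-- local components and either sign.
[cite: FriedbergHoffstein1995, Thm. B (special case below)]
[cite: JetchevSkinnerWan2017, §7.4.2 (arXiv:1512.06894 p. 31), choice of K″, clauses (a)–(d); §4.1 (H) and the sign, p. 17]
[file NumberTheory/EllipticCurves/NonvanishingTwistsPrescribedInert] -/
def friedbergHoffstein_exists_twist_ne_zero_inertAt_splitAt : Prop :=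
  ∀ (W : WeierstrassCurve ℚ) [W.IsElliptic], W.rootNumber = -1 →
    ∀ (S : Finset ℕ), (∀ ℓ ∈ S, ∃ _ : Fact ℓ.Prime, W.HasMultiplicativeReductionAtPrime ℓ) →
      Even S.card → ∀ (M : ℕ), M ≠ 0 →
    ∀ B : ℕ, ∃ (K : Type) (_ : Field K) (_ : NumberField K),
      IsImaginaryQuadratic K ∧ B < (NumberField.discr K).natAbs ∧
        (∀ ℓ ∈ S, ((Ideal.span {(ℓ : ℤ)}).primesOver (𝓞 K)).ncard = 1 ∧
          ¬ (ℓ : ℤ) ∣ NumberField.discr K) ∧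
        (∀ ℓ : ℕ, ℓ.Prime → ℓ ∣ W.conductorNorm ℤ → ℓ ∉ S →
          ((Ideal.span {(ℓ : ℤ)}).primesOver (𝓞 K)).ncard = 2) ∧
        (∀ ℓ : ℕ, ℓ.Prime → ℓ ∣ M → ℓ ∉ S →
          ((Ideal.span {(ℓ : ℤ)}).primesOver (𝓞 K)).ncard = 2) ∧
        (W.quadraticTwist (NumberField.discr K : ℚ)).entireLFunction 1 ≠ 0

end Literature.NumberTheory.EllipticCurves

/-! ## Non-split Cartan variant (bsd-idea-10's (F4) of crux 19109 `EulerHalvesAtThree`, line `cartan`; appended by the cell `bsd-stepL`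
seat `bsd-stepL-tam3-p1` g19) — FriedbergHoffstein1995, KohenPacetti2016 -/

namespace Literature.NumberTheory.EllipticCurves

open scoped Classical NumberField
open WeierstrassCurve NumberField IsDedekindDomain Literature Literature.NumberTheory.EllipticCurves

/-- **Non-vanishing quadratic twist with prescribed inert primes INCLUDING finitely many additive places of conductor exponent two**
(Friedberg–Hoffstein, Ann. of Math. 142 (1995), Thm. B — the sibling `friedbergHoffstein_exists_twist_ne_zero_inertAt` with a second finite
set `C` of primes `q` with `q² ∥ N_W` that are ALSO required to be inert in `K`; the use is Kohen–Pacetti's Heegner-point construction on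
non-split CARTAN curves, J. Number Theory 2016 = arXiv:1403.7801v3, §3: the imaginary quadratic field is INERT at the additive primes of
square conductor served by a Cartan non-split level structure, Thm. 3.6 ∕ Thm. 3.7). SIGN: for `d_K` coprime to `N_W` (every prime of
`N_W` is unramified in `K` below) `w(W^{(d_K)}) = χ_{d_K}(−N_W)·w(W)` with `χ_{d_K}(−1) = −1`, `χ_{d_K}(ℓ) = −1` exactly at the inert
`ℓ ∈ S ∪ C`, and the primes of `C` enter `N_W` SQUARED — so `w(W^{(d_K)}) = (−1)^{#S + 1}·w(W) = +1` when `w(W) = −1` and `#S` is even,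
independently of `C`: the sign hypothesis of Thm. B holds for the prescribed local data (`χ_ℓ` unramified quadratic at `ℓ ∈ S ∪ C`, trivial at
the other primes of `N_W`, `χ_∞ = sgn`), and Thm. B gives infinitely many such `d_K` with `L(W^{(d_K)}, 1) ≠ 0`, hence one beyond every
bound `B`. For `W/ℚ` elliptic with `w(W) = −1`, `S` a finite set of multiplicative primes of even cardinality and `C` a finite set of primes
`q` with `q² ∣ N_W`, `q³ ∤ N_W`: for every `B` there is an imaginary quadratic `K` with `|d_K| > B`, every `ℓ ∈ S ∪ C` inert in `K` (one
prime of `𝓞_K` above `ℓ`, `ℓ ∤ d_K`), every prime `ℓ ∣ N_W` outside `S ∪ C` split in `K`, and `L(W^{(d_K)}, 1) ≠ 0`. VERBATIM the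
`hFHC` binder of `Summit.BirchSwinnertonDyer.BirchSwinnertonDyer.Theorems.CartanKernel.cartanRoadAtThree_of_inputs` and bsd-idea-10's
`friedbergHoffstein_exists_twist_ne_zero_inertAt_sq` (`Cruxes/EulerHalvesAtThree/Lines/cartan.lean`). Friedberg–Hoffstein's text is not
held (acq-00930, cite-only); the general Thm. B is paraphrased in the module docstring. Named fact; nothing asserted.
-- TODO(general form): Friedberg–Hoffstein Thm. B for any cuspidal `π` on `GL₂/F`, any finite set of places with prescribed quadratic
-- local components and either sign.
[cite: FriedbergHoffstein1995, Thm. B (special case below)]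
[cite: KohenPacetti2016, §3, Thm. 3.6 and Thm. 3.7 (arXiv:1403.7801v3) (the use: K inert at the Cartan primes)]
[cite: JetchevSkinnerWan2017, §7.4.2 (arXiv:1512.06894 p. 31) and §4.1 p. 17 (the sibling use and the sign)] -/
def friedbergHoffstein_exists_twist_ne_zero_inertAt_sq : Prop :=
  ∀ (W : WeierstrassCurve ℚ) [W.IsElliptic], W.rootNumber = -1 →
    ∀ (S C : Finset ℕ), (∀ ℓ ∈ S, ∃ _ : Fact ℓ.Prime, W.HasMultiplicativeReductionAtPrime ℓ) →
      Even S.card →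
      (∀ q ∈ C, ∃ _ : Fact q.Prime, q ^ 2 ∣ W.conductorNorm ℤ ∧ ¬ q ^ 3 ∣ W.conductorNorm ℤ) →
    ∀ B : ℕ, ∃ (K : Type) (_ : Field K) (_ : NumberField K),
      IsImaginaryQuadratic K ∧ B < (NumberField.discr K).natAbs ∧
        (∀ ℓ ∈ S ∪ C, ((Ideal.span {(ℓ : ℤ)}).primesOver (𝓞 K)).ncard = 1 ∧
          ¬ (ℓ : ℤ) ∣ NumberField.discr K) ∧
        (∀ ℓ : ℕ, ℓ.Prime → ℓ ∣ W.conductorNorm ℤ → ℓ ∉ S → ℓ ∉ C →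
          ((Ideal.span {(ℓ : ℤ)}).primesOver (𝓞 K)).ncard = 2) ∧
        (W.quadraticTwist (NumberField.discr K : ℚ)).entireLFunction 1 ≠ 0

end Literature.NumberTheory.EllipticCurves

/-! ## Non-split Cartan variant with `2` split when `2 ∤ N` (route `RamifiedHeegnerPair`, crux U₁ 26022, line `nscartan`: the `hFH` binder of
`Summit.BirchSwinnertonDyer.BirchSwinnertonDyer.Theorems.LeafCartanKernel` p767931; appended by the route pen `bsd-wall-pss3` g25 at the lead
prover's request) — FriedbergHoffstein1995, KohenPacetti2016, JetchevSkinnerWan2017 -/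

namespace Literature.NumberTheory.EllipticCurves

open scoped Classical NumberField
open WeierstrassCurve NumberField IsDedekindDomain Literature Literature.NumberTheory.EllipticCurves

/-- **Non-vanishing quadratic twist with prescribed inert primes (multiplicative, even in number, and additive of conductor exponent two)
AND the auxiliary prime `2` SPLIT when `2 ∤ N_W`** (Friedberg–Hoffstein, Ann. of Math. 142 (1995), Thm. B — the sibling
`friedbergHoffstein_exists_twist_ne_zero_inertAt_sq` with ONE further prescribed local component: at the place `2`, when `2` does not divide
the conductor, the local quadratic character is required to be TRIVIAL, i.e. `2` splits in `K` (`d_K ≡ 1 (mod 8)`), exactly as the auxiliary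
splitting clause (c) «`p` splits in `𝒦″`» of Jetchev–Skinner–Wan, Camb. J. Math. 5 (2017) §7.4.2, p. 31, at a prime `p ∤ N` — there the use is
recorded VERBATIM in the module docstring; the sibling `friedbergHoffstein_exists_twist_ne_zero_inertAt_splitAt` is the same move for an
arbitrary auxiliary integer `M` with `C = ∅`). USE: the leaf Cartan kernel of the route `RamifiedHeegnerPair` (crux U₁, line `nscartan`;
`Theorems/RamifiedHeegnerPairLeafCartanKernel.lean`, binder `hFH`, token for token the statement below) needs the Cartan twist field `K` (inert
at the additive Cartan primes `C`, Kohen–Pacetti, J. Number Theory 2016 = arXiv:1403.7801v3 §3, Thm. 3.6 ∕ 3.7) to have ODD discriminant, which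
the splitting of `2` forces when `2 ∤ N_W` (when `2 ∣ N_W` and `2 ∉ S ∪ C` the conductor clause already splits `2`). SIGN: the local
character at the auxiliary split place `2` is trivial, so `w(W^{(d_K)}) = χ_{d_K}(−N_W)·w(W) = (−1)^{#S + 1}·w(W) = +1` for `w(W) = −1` and `#S`
even, independently of `C` and of the clause at `2` — the computation of the sibling `_inertAt_sq` verbatim; a quadratic field with the
prescribed (unramified) behaviour at the finitely many places `S ∪ C ∪ {2} ∪ {ℓ ∣ N_W}` exists (Chinese remainder ∕ Dirichlet), so the sign
hypothesis of Thm. B («some `ξ` with the prescribed local components has `ε(π ⊗ ξ, 1/2) = +1`») holds, and Thm. B gives infinitely many such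
`d_K` with `L(W^{(d_K)}, 1) ≠ 0`, hence one beyond every bound `B`. For `W/ℚ` elliptic with `w(W) = −1`, `S` a finite set of multiplicative
primes of even cardinality and `C` a finite set of primes `q` with `q² ∣ N_W`, `q³ ∤ N_W`: for every `B` there is an imaginary quadratic `K`
with `|d_K| > B`, every `ℓ ∈ S ∪ C` inert in `K` (one prime of `𝓞_K` above `ℓ`, `ℓ ∤ d_K`), every prime `ℓ ∣ N_W` outside `S ∪ C` split in
`K`, `2` split in `K` if `2 ∤ N_W`, and `L(W^{(d_K)}, 1) ≠ 0`. Friedberg–Hoffstein's text is not held (acq-00930, cite-only); the general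
Thm. B is paraphrased in the module docstring. Named fact; nothing asserted.
-- TODO(general form): Friedberg–Hoffstein Thm. B for any cuspidal `π` on `GL₂/F`, any finite set of places with prescribed quadratic
-- local components and either sign (would subsume this file's three special cases and `NonvanishingTwistsPrescribedRamification.lean`).
[cite: FriedbergHoffstein1995, Thm. B (special case below)]
[cite: KohenPacetti2016, §3, Thm. 3.6 and Thm. 3.7 (arXiv:1403.7801v3) (the use: K inert at the Cartan primes)]
[cite: JetchevSkinnerWan2017, §7.4.2 (arXiv:1512.06894 p. 31) clause (c) (the auxiliary split prime) and §4.1 p. 17 (the sign)] -/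
def friedbergHoffstein_exists_twist_ne_zero_inertAt_sq_splitTwo : Prop :=
  ∀ (W : WeierstrassCurve ℚ) [W.IsElliptic], W.rootNumber = -1 →
    ∀ (S C : Finset ℕ), (∀ ℓ ∈ S, ∃ _ : Fact ℓ.Prime, W.HasMultiplicativeReductionAtPrime ℓ) →
      Even S.card →
      (∀ q ∈ C, ∃ _ : Fact q.Prime, q ^ 2 ∣ W.conductorNorm ℤ ∧ ¬ q ^ 3 ∣ W.conductorNorm ℤ) →
    ∀ B : ℕ, ∃ (K : Type) (_ : Field K) (_ : NumberField K),
      IsImaginaryQuadratic K ∧ B < (NumberField.discr K).natAbs ∧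
        (∀ ℓ ∈ S ∪ C, ((Ideal.span {(ℓ : ℤ)}).primesOver (𝓞 K)).ncard = 1 ∧
          ¬ (ℓ : ℤ) ∣ NumberField.discr K) ∧
        (∀ ℓ : ℕ, ℓ.Prime → ℓ ∣ W.conductorNorm ℤ → ℓ ∉ S → ℓ ∉ C →
          ((Ideal.span {(ℓ : ℤ)}).primesOver (𝓞 K)).ncard = 2) ∧
        (¬ 2 ∣ W.conductorNorm ℤ → ((Ideal.span {(2 : ℤ)}).primesOver (𝓞 K)).ncard = 2) ∧
        (W.quadraticTwist (NumberField.discr K : ℚ)).entireLFunction 1 ≠ 0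

end Literature.NumberTheory.EllipticCurves
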